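import Mathlib.RingTheory.MvPowerSeries.Basic
import Mathlib.Algebra.MvPolynomial.PDeriv
import Mathlib.RingTheory.Algebraic.Defs
import HarnessLib

/-!
# Algebraic power series over a field admit a one-generator étale presentation
# (Nagata, *Local Rings*, (44.1): `K⟨t⟩` is the henselisation of `K[t]_{(t)}`; Swan 1998, Thm. 2.5: structure of
# étale neighbourhoods; the pair as used by Castro-Jiménez–Popescu–Rond 2018, proof of Lemma 2.2)

Layer `Literature/RingTheory/MvPowerSeries` (family `periods`; cite/fact request `wi-98549` of the decomp-kz cell —
writer g4 for lens-2 g8, ask W2, critic-cleared 2026-08-30T11:22Z — realised by a literature-prover seat of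
`pub-hsemireg` serving the role queue). A NAMED FACT (net debt +1, the request's COSTUME(cite)) with its degenerate
witness `d = 0` PROVED; no `sorry`, no instance, no notation.

## Source, verbatim

[CastrojimenezPopescuRond2018] F.-J. Castro-Jiménez, D. Popescu, G. Rond, *Linear nested Artin approximation theorem for
algebraic power series*, manuscripta math. 158 (2018) 55–73, **proof of Lemma 2.2, p. 58** [galaxy:pdf:5102038967989805800
p0004:L23–L25]: «**Lemma 2.2.** Let `(A, 𝔪)` be a complete normal local domain, `x = (x_1, …, x_n)` and `y = (y_1, …, y_m)`.
Let `B = A⟦x⟧⟨y⟩` be the algebraic closure of `A⟦x⟧[y]` in `A⟦x, y⟧` and `f ∈ B`. […] *Proof.* […] Note that `B` is the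
Henselization of `C = A⟦x⟧[y]_{(𝔪,x,y)}` by [19, 44.1] and so there exists some étale neighborhood of `C` containing `f`.
Using for example [26, Theorem 2.5] there exists a monic polynomial `F` in `u` over `A⟦x⟧[y]` and `h ∈ (𝔪, x, y)A⟦x⟧⟨y⟩`
such that `F(h) = 0`, `(∂F/∂u)(h) ∉ (𝔪, x, y)` and `f ∈ A⟦x⟧[y, h]_{(𝔪,x,y) ∩ A⟦x⟧[y,h]}`, let us say `f = P(y,h)/Q(y,h)` for
some `P(y,u), Q(y,u) ∈ A⟦x⟧[y,u]`, `Q(y,h) ∉ (𝔪,x,y) ∩ A⟦x⟧[y,h]`.» with [19] = [Nagata1962LocalRings] M. Nagata, *Local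
Rings*, Interscience Tracts 13 (1962), (44.1) [p0018:L24] and [26] = [Swan1998NeronPopescu] R. G. Swan, *Néron–Popescu
desingularization*, in: Algebra and geometry (Taipei, 1995), Lect. Algebra Geom. 2, Int. Press (1998) 135–192, Theorem 2.5
[p0019:L2].

## What is typed

The special case `A = K` a field (a complete normal local domain with `𝔪 = 0`), `n = 0`, `y = (t_1, …, t_d)`: then
`B = K⟨t⟩ ⊂ K⟦t⟧` is the ring of ALGEBRAIC power series — the `G ∈ K⟦t_1, …, t_d⟧` algebraic over `K[t_1, …, t_d]`
(Mathlib `IsAlgebraic (MvPolynomial (Fin d) K) G` for the algebra structure `MvPolynomial σ K → MvPowerSeries σ K`) —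
and `∉ (t)` for an element of the local ring `K⟨t⟩` reads «constant coefficient `≠ 0`». The printed sentence gives
`F, P, Q ∈ K[t][u] = K[t_1, …, t_d, u]` and `h ∈ K⟨t⟩` with `F(t, h) = 0`, `(∂F/∂u)(t, h)(0) ≠ 0`, `Q(t, h)(0) ≠ 0` and
`f · Q(t, h) = P(t, h)`; the fact below records exactly these four relations (with `u` the LAST of `d + 1` polynomial
variables, evaluation at `(t_1, …, t_d, h)` = `pwPoint h`), DROPPING the printed extras «`F` monic», «`h ∈ (t)`» and
«`h` algebraic» (a WEAKER statement than the print, as the requester wants it), and adding the requester's standing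
hypothesis `CharZero K` (the print has none; weaker again).

* `pwPoint h : Fin (d + 1) → K⟦t_1..t_d⟧` — the evaluation point `(t_1, …, t_d, h)` (definition with body);
* **`EtaleAlgebraicPowerSeries d : Prop`** — the NAMED FACT, text = the requester's (decomp-kz lens-2 g8
  `NashEtaleMultiGen.lean` l.757, sha256 b6d471da…) verbatim;
* `etaleAlgebraicPowerSeries_zero : EtaleAlgebraicPowerSeries 0` — the degenerate witness `d = 0` PROVED (a power series
  in no variables is the constant `C (G 0)`: `h := 0`, `F := u`, `A := C (G 0)`, `B := 1`), the requester's sanity check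
  re-proved here so that the typing is visibly non-vacuous in the tree.

HONEST SCOPE. Not typed: the general `A⟦x⟧⟨y⟩` statement; «`K⟨t⟩` is the henselisation of `K[t]_{(t)}`» itself
([Nagata1962LocalRings, (44.1)]; Mathlib has `HenselianLocalRing` but no henselisation-as-colimit API); the local
structure of étale algebras is Mathlib's `Algebra.IsEtaleAt.exists_isStandardEtale` (Stacks 00UE) and is NOT re-derived.
The discharge `theorem EtaleAlgebraicPowerSeries_holds` would assemble: algebraic closure of `K[t]` in `K⟦t⟧` is
henselian + ind-étale over `K[t]_{(t)}` (XL on present carriers). Grade: PRINT-SYNTHESIS of two REFEREED theorems, the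
synthesising sentence itself printed in a refereed proof. Consumer: decomp-kz `SpecialStrataViaPowerSeries` ∕
`MultiGenSpecialAt` (support item stmt-KontsevichZagierPeriods-31659 `NashEtaleLocal`). Nothing here bears on any summit
statement by itself.

presearch: «algebraic power series henselization étale neighbourhood standard étale one generator» → [galaxy:pdf:
5102038967989805800 p0004:L25] (the sentence typed) · [corpus: paper:arxiv-1601.06654 p6 (Nested Artin approximation —
same device)] · Mathlib `Algebra.IsEtaleAt.exists_isStandardEtale`, `HenselianLocalRing` · tree `Literature/RingTheory/
Etale/IndEtalePresentation.lean`, `HenselLemma/*` (no algebraic-power-series ring; `rg "AlgebraicPowerSeries|henseli"`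
in `Literature/RingTheory` → unrelated hits only): nothing restated.

## References

* [CastrojimenezPopescuRond2018] Castro-Jiménez–Popescu–Rond, manuscripta math. 158 (2018) 55–73, Lemma 2.2 and its proof
  (p. 58). doi:10.1007/s00229-018-1025-0.
* [Nagata1962LocalRings] M. Nagata, *Local Rings*, Interscience Tracts in Pure and Applied Mathematics 13 (1962), (44.1).
* [Swan1998NeronPopescu] R. G. Swan, *Néron–Popescu desingularization*, Lect. Algebra Geom. 2 (1998) 135–192, Thm. 2.5.
* The Stacks Project, Tag 00UE (= Mathlib `Algebra.IsEtaleAt.exists_isStandardEtale`).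
-/

noncomputable section

namespace Literature.RingTheory.MvPowerSeries

/-- **The evaluation point `(t_1, …, t_d, h) ∈ K⟦t⟧^{d+1}`** for polynomials in `d + 1` variables, the last variable
`u = Fin.last d` going to `h` (the requester's `pwPoint`, verbatim). Definition with body.
[cite: CastrojimenezPopescuRond2018, proof of Lemma 2.2, p. 58 («F(h) = 0 … P(y,h)/Q(y,h)»)] -/
def pwPoint {d : ℕ} {K : Type} [Field K] (h : MvPowerSeries (Fin d) K) : Fin (d + 1) → MvPowerSeries (Fin d) K :=
  Fin.snoc (fun i : Fin d => (MvPowerSeries.X i : MvPowerSeries (Fin d) K)) h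

/-- `pwPoint h` at the last variable is `h`. [cite: CastrojimenezPopescuRond2018, proof of Lemma 2.2, p. 58] -/
@[simp] theorem pwPoint_last {d : ℕ} {K : Type} [Field K] (h : MvPowerSeries (Fin d) K) :
    pwPoint h (Fin.last d) = h := by
  simp [pwPoint]

/-- `pwPoint h` at a variable `t_i`, `i < d`, is `t_i`. [cite: CastrojimenezPopescuRond2018, proof of Lemma 2.2, p. 58] -/
@[simp] theorem pwPoint_castSucc {d : ℕ} {K : Type} [Field K] (h : MvPowerSeries (Fin d) K) (i : Fin d) :
    pwPoint h (Fin.castSucc i) = MvPowerSeries.X i := by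
  simp [pwPoint]

/-- **NAMED FACT — algebraic power series admit a one-generator étale presentation.** For a field `K` of characteristic
`0` and `G ∈ K⟦t_1, …, t_d⟧` algebraic over `K[t_1, …, t_d]`, there are `h ∈ K⟦t⟧` and `F, A, B ∈ K[t_1, …, t_d, u]` with
`F(t, h) = 0`, `(∂F/∂u)(t, h)(0) ≠ 0`, `B(t, h)(0) ≠ 0` and `G · B(t, h) = A(t, h)` — the case `A = K`, `n = 0` of «`B` is the
Henselization of `C = A⟦x⟧[y]_{(𝔪,x,y)}` by [Nagata, 44.1] and so there exists some étale neighborhood of `C` containing `f`.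
Using for example [Swan, Theorem 2.5] there exists a monic polynomial `F` in `u` over `A⟦x⟧[y]` and `h ∈ (𝔪, x, y)A⟦x⟧⟨y⟩` such
that `F(h) = 0`, `(∂F/∂u)(h) ∉ (𝔪, x, y)` and […] `f = P(y,h)/Q(y,h)` […], `Q(y,h) ∉ (𝔪,x,y)`», weakened by dropping «monic»,
«`h ∈ (t)`», «`h` algebraic» and by assuming `char K = 0` (requester's text verbatim, decomp-kz lens-2 g8). A `Prop`
definition; its proof (`_holds`) is NOT in the tree (henselisation API absent) — consumers take `(h : EtaleAlgebraicPowerSeries d)`.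
[cite: CastrojimenezPopescuRond2018, proof of Lemma 2.2, p. 58] [cite: Nagata1962LocalRings, (44.1)]
[cite: Swan1998NeronPopescu, Thm. 2.5] -/
def EtaleAlgebraicPowerSeries (d : ℕ) : Prop :=
  ∀ (K : Type) [Field K] [CharZero K] (G : MvPowerSeries (Fin d) K),
    IsAlgebraic (MvPolynomial (Fin d) K) G →
    ∃ (h : MvPowerSeries (Fin d) K) (F A B : MvPolynomial (Fin (d + 1)) K),
      MvPolynomial.aeval (pwPoint h) F = 0 ∧
      MvPowerSeries.constantCoeff
          (MvPolynomial.aeval (pwPoint h) (MvPolynomial.pderiv (Fin.last d) F)) ≠ 0 ∧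
      MvPowerSeries.constantCoeff (MvPolynomial.aeval (pwPoint h) B) ≠ 0 ∧
      G * MvPolynomial.aeval (pwPoint h) B = MvPolynomial.aeval (pwPoint h) A

/-- **The degenerate witness `d = 0`, PROVED**: a power series in no variables is the constant `C (G 0)`, presented by
`h := 0`, `F := u`, `A := C (G 0)`, `B := 1` (the requester's sanity check `etaleAlgebraicPowerSeries_zero`, re-proved).
[cite: CastrojimenezPopescuRond2018, proof of Lemma 2.2, p. 58] -/
theorem etaleAlgebraicPowerSeries_zero : EtaleAlgebraicPowerSeries 0 := by
  intro K _ _ G _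
  have hG : (MvPowerSeries.C (MvPowerSeries.constantCoeff G) : MvPowerSeries (Fin 0) K) = G := by
    refine MvPowerSeries.ext fun m => ?_
    obtain rfl : m = 0 := Subsingleton.elim _ _
    rw [MvPowerSeries.coeff_zero_C]
    rfl
  refine ⟨0, MvPolynomial.X (Fin.last 0), MvPolynomial.C (MvPowerSeries.constantCoeff G), 1, ?_, ?_, ?_, ?_⟩
  · rw [MvPolynomial.aeval_X, pwPoint_last]
  · rw [MvPolynomial.pderiv_X_self]; simp
  · simp
  · simp [MvPowerSeries.algebraMap_apply, hG]

end Literature.RingTheory.MvPowerSeries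

end
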